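import Literature.MathematicalPhysics.QuantumFieldTheory.BalabanImbrieJaffe1984to88.BIJ88PolymerRep5134Gauss
import Literature.MathematicalPhysics.QuantumFieldTheory.BalabanImbrieJaffe1984to88.BIJ88TruncatedPair306
import Literature.MathematicalPhysics.QuantumFieldTheory.BalabanImbrieJaffe1984to88.BIJ88SDerivative305

/-!
# `BalabanImbrieJaffe1984to88.BIJ88PolymerRep5134GaussWitness` — T. Bałaban, J. Imbrie, A. Jaffe, *Effective action and cluster properties of
the abelian Higgs model*, Commun. Math. Phys. **114** (1988) 257–315 [BalabanImbrieJaffe1988], §5.13 p. 306 [PDF 50], display (5.13.4) (left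
equality, the polymer representation `⟨Π_{i∈I} f(□_i)⟩_1 = Σ_{{X_α} filling Λ₁₀} Π_α g₁(X_α)`): **a GAUSSIAN WITNESS, in the model of
`BIJ88PolymerRep5134Gauss` (the actual `⟨·⟩_{s,X}` expectations of Sect. 5.13: `e^{−½⟨Φ,Δ_sΦ⟩}dΦ` over the fields of `X`, cube-local
observables), that (5.13.4) holds with `{X_α}` ranging over the ADMISSIBLE fillings (= cluster configurations, `polymerRep_gauss`) and FAILS when
`{X_α}` is read as ranging over ALL set partitions of `Λ₁₀` into unions of cubes**: four cubes in a row, one real field component per cube,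
precision `pathΔ` (`2` on the diagonal, `−1` between neighbours), `f(□₀) = Φ₀²`, `f(□₃) = Φ₃²`, `f(□₁) = f(□₂) = 1`; then
`g₁({□₀,□₁}) = ⟨Φ₀²⟩_{coupled} − ⟨Φ₀²⟩_{decoupled} = 2/3 − 1/2 = 1/6 = g₁({□₂,□₃})` and
**`Σ_{ALL set partitions P} Π_{X∈P} g₁(X) = ⟨Φ₀²Φ₃²⟩_1 + 1/36 ≠ ⟨Φ₀²Φ₃²⟩_1 = Σ_{ADMISSIBLE P} Π_{X∈P} g₁(X)`** (`sum_setPartitions_ne_univ`).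
This upgrades the combinatorial witness `BIJ88PolymerRep5134.sum_setPartitions_ne_W4` (an abstract cluster-product weight) to the paper's own
class of measures (reading note GAPS.md G-C2-p25-03).

statement-level skeleton of published theorems with citation tags; proofs where landed; nothing here is a claim about the Yang–Mills mass gap

PDF held: `paper:balaban1988-cmp114-bij-abelian-higgs-effective-action` (journal page = PDF page + 256); pp. 305–306 = PDF 49–50 rendered and
read as images this session (p25 seat `renders/original-p049-x2.png`, `…p050-x2.png`).

**The print (verbatim, p. 306 [PDF 50]).** *"The form Δ has a range less than ½r(e_k). The f(□_i) do not couple different □_i. Hence only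
adjacent □_i with s_i ≠ 0 interact in the above formula. Thus our expression for ⟨Π_{i∈I} f(□_i)⟩_1 factorizes over the connected components
of Γ. … The expression also factorizes over the □_{i′}, i′ ∈ I∖Γ. Call the factorization regions clusters. … Given some region X, a union of
□_i, we sum Γ over all subsets of {i ∈ I : □_i ⊂ X}, such that X is a single cluster. … ⟨·⟩_{s_Γ,X} is defined by integrating over the fields
in X only. … Σ_{S_Y}Σ_{S_5} e^{−V^{(k)}_{const}(Λ^{(k)}_8)} Σ_{{X_α} filling Λ^{(k)}_{10}} Π_α g₁(X_α) = … (5.13.4)"*; p. 305 [PDF 49]: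
*"□_iΔ_s□_{i′} = s_is_{i′}□_iΔ□_{i′}, i′ ≠ i, □_iΔ_s□_i = □_iΔ□_i"*.

**What is proved (0 `sorry`, standard axioms — `decide` only on finite bookkeeping over `Fin 4`, no `ofReduceBool` — 0 new `Prop` facts).**
* §1 (general `blk`, `Δ`, `f`, no linear term): `prec_posDef` (corner precisions of sub-regions are positive definite for `Δ ≻ 0`, p02's
  `interpForm_posDef`); **`expect_eq_of_obs_sq`**: `⟨(Φ·w)²⟩_{s,X} = ⟨A⁻¹w,w⟩`, `A = prec X s` (p13's `BIJ88TruncatedPair306.pair_vacuum`,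
  normalisation `BIJ88SDerivative305.integral_weight_mul_source_pos`).
* §2 the model `nn4` (consecutive cubes abut), `cube4 = id`, `pathΔ` (`pathΔ_posDef`: `⟨x,Δx⟩ = x₀²+(x₀−x₁)²+(x₁−x₂)²+(x₂−x₃)²+x₃²`),
  `obs4`; the hypotheses of `isClusterFactorizing_zG` (`pathΔ_range`, `obs4_local`).
* §3 `zW X Λ := zG cube4 pathΔ 0 obs4 X Λ` (the corner expectations `⟨Π_{i∈X}f(□_i)⟩_{1_Λ,X}`), **`isClusterFactorizing_zW`**;
  **`zW_two_site`** (transport of a two-site marginal to `Fin 2 → ℝ` by `integral_transport`/`quadForm_transport`, then `pair_vacuum` and the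
  explicit inverse of `[[2,−t],[−t,2]]`): `⟨Φ_k²⟩ = 2/(4−t²)`; `zW_pair01`, `zW_pair23`: `⟨Φ₀²⟩_{1_Λ,{0,1}} = 2/(4 − (s₀s₁)²)` (`2/3` coupled,
  `1/2` decoupled — the only place the interpolation `s_is_j` enters).
* §4 **`g1_pair01`, `g1_pair23`**: `g₁({0,1}) = g₁({2,3}) = 1/6` (`g1_of_two_le`: `g₁ = cornerSum` for a connected pair).
* §5 `prod_g1_of_not_isAdmissible` (a non-admissible set partition of four cubes is a pair of complementary `2`-sets; its term is `1/36` for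
  `{{0,1},{2,3}}`, else `0` since a disconnected pair has `g₁ = 0`), **`sum_setPartitions_univ`**: `Σ_{all P} Π g₁ = zW univ univ + 1/36`
  (`BIJ88PolymerRep5134.sum_setPartitions_eq`), **`sum_setPartitions_ne_univ`**: `≠ zW univ univ`, `= Σ_{admissible}` (`polymerRep`).

**Honest scope.** One real field component per cube and no constraint `δ_{Ax}` (as in p13's Gaussian files and `BIJ88PolymerRep5134Gauss`);
the activities are in CORNER form (`∫ds_Γ∂_Γ` of a function multi-affine in each `s_i` on the segment is the alternating corner sum —
`BIJ88PolymerRep5134Deriv` for the printed derivative form under p02's FTC hypotheses); the witness says nothing against the paper's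
convergence claims — it pins down which fillings (5.13.4) sums over. NOT summit progress; NOT continuum; NOT Clay. Imports:
`BIJ88PolymerRep5134Gauss`, `BIJ88TruncatedPair306`, `BIJ88SDerivative305`; modifies nothing. Cell `lit-balaban` Phase 2, seat p25 gen 8; row
C2.Eq5.13.3-5.13.4 (owner r16, referee ref-5).
-/

noncomputable section

namespace Literature.MathematicalPhysics.QuantumFieldTheory.BalabanImbrieJaffe1984to88.BIJ88PolymerRep5134GaussWitness

open MeasureTheory Matrix Finset
open scoped BigOperators
open Literature.Probability.LatticeModels (IsSetPartition setPartitions mem_setPartitions)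
open Literature.MathematicalPhysics.QuantumFieldTheory.Balaban1983to89
open B2Eq228Conditioning (weight source)
open BIJ88DirichletForms305 (interpForm interpForm_apply interpForm_posDef)
open BIJ88TruncatedPair306 (pair_vacuum)
open BIJ88SDerivative305 (integral_weight_mul_source_pos)
open BIJ88Clusters5134 BIJ88PolymerRep5134 BIJ88PolymerRep5134Gauss

/-! ## §1 General: positivity of the marginal precisions; the expectation of a squared field component -/

section General

variable {α I : Type} [Fintype α] [DecidableEq α] [Fintype I] [DecidableEq I]
  (blk : α → I) (Δ : Matrix α α ℝ) (f : I → (α → ℝ) → ℝ)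

omit [Fintype I] in
/-- the parameter corner lies in the unit cube. [cite: BalabanImbrieJaffe1988, p.305 (Sect. 5.13)] -/
theorem corner_mem_cube (Λ : Finset I) (i : I) : 0 ≤ corner ℝ Λ i ∧ corner ℝ Λ i ≤ 1 := by
  simp only [corner]
  split_ifs <;> norm_num

/-- the precision of an `X`-marginal at a corner is positive definite (principal block of the positive definite `Δ_s`, p02
`interpForm_posDef` — *"To preserve positivity"*, p. 305). [cite: BalabanImbrieJaffe1988, p.305 (Sect. 5.13)] -/
theorem prec_posDef (hΔ : Δ.PosDef) (X : Finset I) (Λ : Finset I) : (prec blk Δ X (corner ℝ Λ)).PosDef :=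
  (interpForm_posDef blk hΔ (corner_mem_cube Λ)).submatrix Subtype.val_injective

omit [Fintype α] [DecidableEq α] [Fintype I] [DecidableEq I] in
/-- with no linear term the source vector of every marginal vanishes. [cite: BalabanImbrieJaffe1988, p.305 (Sect. 5.13)] -/
theorem src_zero (X : Finset I) : src blk (0 : α → ℝ) X = 0 := by
  funext x
  rfl

/-- **the expectation of a squared field component**: if the `X`-observable is `(Φ·w)²` then `⟨(Φ·w)²⟩_{s,X} = ⟨A⁻¹w, w⟩`, `A` the marginal
precision (p13's `pair_vacuum`, no linear term). [cite: BalabanImbrieJaffe1988, p.305–306 (Sect. 5.13)] -/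
theorem expect_eq_of_obs_sq (X : Finset I) (s : I → ℝ) (hA : (prec blk Δ X s).PosDef) (w : BIJ88PolymerRep5134Gauss.Site blk X → ℝ)
    (hobs : ∀ φ, obs blk f X φ = (φ ⬝ᵥ w) * (φ ⬝ᵥ w)) :
    BIJ88PolymerRep5134Gauss.expect blk Δ (0 : α → ℝ) f X s = ((prec blk Δ X s)⁻¹ *ᵥ w) ⬝ᵥ w := by
  have hZ := integral_weight_mul_source_pos hA (src blk (0 : α → ℝ) X)
  rw [src_zero] at hZ
  rw [BIJ88PolymerRep5134Gauss.expect, src_zero]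
  simp_rw [hobs]
  rw [pair_vacuum _ hA 0 w w]
  simp only [dotProduct_zero, mul_zero, add_zero]
  exact mul_div_cancel_right₀ _ hZ.ne'

end General

/-! ## §2 The witness model: four sites = four cubes in a row, nearest-neighbour precision, `f = (Φ₀², 1, 1, Φ₃²)` -/

/-- cubes abut iff consecutive. [cite: BalabanImbrieJaffe1988, (5.13.4) p.306] -/
def nn4 (x y : Fin 4) : Prop := x.val + 1 = y.val ∨ y.val + 1 = x.val

/-- decidability. [cite: BalabanImbrieJaffe1988, (5.13.4) p.306] -/
instance instDecidableRelNn4 : DecidableRel nn4 := fun x y => inferInstanceAs (Decidable (x.val + 1 = y.val ∨ y.val + 1 = x.val))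

/-- one site per cube. [cite: BalabanImbrieJaffe1988, (5.13.4) p.306] -/
abbrev cube4 (x : Fin 4) : Fin 4 := x

/-- the precision `−Δ`: `2` on the diagonal, `−1` between consecutive sites (a positive definite nearest-neighbour form of range 1).
[cite: BalabanImbrieJaffe1988, (5.13.4) p.306] -/
def pathΔ : Matrix (Fin 4) (Fin 4) ℝ := Matrix.of fun x y => if x = y then 2 else if nn4 x y then -1 else 0

/-- the observables: `f(□₀) = Φ₀²`, `f(□₃) = Φ₃²`, `f(□₁) = f(□₂) = 1`. [cite: BalabanImbrieJaffe1988, (5.13.4) p.306] -/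
def obs4 (i : Fin 4) (φ : Fin 4 → ℝ) : ℝ := if i = 0 ∨ i = 3 then φ i ^ 2 else 1

/-- the observables are cube-local. [cite: BalabanImbrieJaffe1988, (5.13.4) p.306] -/
theorem obs4_local (i : Fin 4) (φ ψ : Fin 4 → ℝ) (h : ∀ x, cube4 x = i → φ x = ψ x) : obs4 i φ = obs4 i ψ := by
  simp only [obs4, h i rfl]

/-- the precision couples only consecutive sites. [cite: BalabanImbrieJaffe1988, (5.13.4) p.306] -/
theorem pathΔ_range (x y : Fin 4) (hne : cube4 x ≠ cube4 y) (hn : ¬ nn4 (cube4 x) (cube4 y)) : pathΔ x y = 0 := by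
  simp only [pathΔ, Matrix.of_apply, if_neg (show x ≠ y from hne), if_neg (show ¬ nn4 x y from hn)]

/-- the precision is symmetric. [cite: BalabanImbrieJaffe1988, (5.13.4) p.306] -/
theorem pathΔ_isHermitian : pathΔ.IsHermitian := by
  rw [Matrix.IsHermitian]
  ext x y
  simp only [conjTranspose_apply, star_trivial, pathΔ, Matrix.of_apply, nn4]
  fin_cases x <;> fin_cases y <;> simp (config := { decide := true })

/-- the precision is positive definite (`⟨x,Δx⟩ = x₀² + (x₀−x₁)² + (x₁−x₂)² + (x₂−x₃)² + x₃²`). [cite: BalabanImbrieJaffe1988, (5.13.4) p.306] -/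
theorem pathΔ_posDef : pathΔ.PosDef := by
  rw [posDef_iff_dotProduct_mulVec]
  refine ⟨pathΔ_isHermitian, fun x hx => ?_⟩
  have hq : star x ⬝ᵥ (pathΔ *ᵥ x)
      = x 0 ^ 2 + (x 0 - x 1) ^ 2 + (x 1 - x 2) ^ 2 + (x 2 - x 3) ^ 2 + x 3 ^ 2 := by
    simp only [star_trivial, dotProduct, mulVec, Fin.sum_univ_four, pathΔ, Matrix.of_apply, nn4]
    simp (config := {decide := true})
    ring
  rw [hq]
  have h0 := sq_nonneg (x 0)
  have h1 := sq_nonneg (x 0 - x 1)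
  have h2 := sq_nonneg (x 1 - x 2)
  have h3 := sq_nonneg (x 2 - x 3)
  have h4 := sq_nonneg (x 3)
  by_contra hle
  push Not at hle
  have s0 : x 0 ^ 2 = 0 := by linarith
  have s1 : (x 0 - x 1) ^ 2 = 0 := by linarith
  have s2 : (x 1 - x 2) ^ 2 = 0 := by linarith
  have s3 : (x 2 - x 3) ^ 2 = 0 := by linarith
  have e0 : x 0 = 0 := pow_eq_zero_iff (n := 2) (by norm_num) |>.1 s0
  have e1 : x 1 = 0 := by have := pow_eq_zero_iff (n := 2) (by norm_num) |>.1 s1; linarith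
  have e2 : x 2 = 0 := by have := pow_eq_zero_iff (n := 2) (by norm_num) |>.1 s2; linarith
  have e3 : x 3 = 0 := by have := pow_eq_zero_iff (n := 2) (by norm_num) |>.1 s3; linarith
  exact hx (funext fun i => by fin_cases i <;> assumption)

/-! ## §3 The two-cube expectations `⟨Φ₀²⟩_{1_Λ,{0,1}}`, `⟨Φ₃²⟩_{1_Λ,{2,3}}`: `2/3` coupled, `1/2` decoupled -/

/-- the corner expectations of the witness model. [cite: BalabanImbrieJaffe1988, (5.13.4) p.306] -/
def zW (X Λ : Finset (Fin 4)) : ℝ := zG cube4 pathΔ (0 : Fin 4 → ℝ) obs4 X Λ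

/-- **the witness expectations are cluster-factorizing** (instance of `isClusterFactorizing_zG`), so (5.13.4) in the admissible
bookkeeping holds for them. [cite: BalabanImbrieJaffe1988, (5.13.4) p.306] -/
theorem isClusterFactorizing_zW : IsClusterFactorizing nn4 zW :=
  isClusterFactorizing_zG cube4 pathΔ 0 obs4 nn4 pathΔ_range obs4_local

/-- with no linear term the source factor is `1`. [cite: BalabanImbrieJaffe1988, p.305 (Sect. 5.13)] -/
theorem source_zero_apply {T : Type} [Fintype T] (v : T → ℝ) : source (0 : T → ℝ) v = 1 := by
  simp [B2Eq228Conditioning.source]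

/-- **two-site evaluation**: if a region has two sites (`e : Fin 2 ≃ Site X`), its observable is the square of the field at the site
`e k`, and its corner precision is `[[2, −t], [−t, 2]]` with `t² < 4`, then `⟨Φ(e k)²⟩ = 2/(4 − t²)` (transport to `Fin 2 → ℝ`, p13's
`pair_vacuum`, the explicit inverse `[[2,t],[t,2]]/(4−t²)`). [cite: BalabanImbrieJaffe1988, p.305–306 (Sect. 5.13)] -/
theorem zW_two_site (X Λ : Finset (Fin 4)) (e : Fin 2 ≃ BIJ88PolymerRep5134Gauss.Site cube4 X) (k : Fin 2)
    (hobs : ∀ φ : BIJ88PolymerRep5134Gauss.Site cube4 X → ℝ, obs cube4 obs4 X φ = φ (e k) ^ 2) (t : ℝ)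
    (hmat : (prec cube4 pathΔ X (corner ℝ Λ)).submatrix e e = !![2, -t; -t, 2]) (ht : t ^ 2 < 4) :
    zW X Λ = 2 / (4 - t ^ 2) := by
  have hA : (prec cube4 pathΔ X (corner ℝ Λ)).PosDef := prec_posDef cube4 pathΔ pathΔ_posDef X Λ
  have hA' : (!![2, -t; -t, 2] : Matrix (Fin 2) (Fin 2) ℝ).PosDef := by
    rw [← hmat]
    exact hA.submatrix e.injective
  -- transport both integrals to `Fin 2 → ℝ`
  have htr : ∀ G : (BIJ88PolymerRep5134Gauss.Site cube4 X → ℝ) → ℝ,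
      ∫ φ, G φ * (weight (prec cube4 pathΔ X (corner ℝ Λ)) φ * source (src cube4 (0 : Fin 4 → ℝ) X) φ)
        = ∫ ψ : Fin 2 → ℝ, G (fun y => ψ (e.symm y)) * (weight (!![2, -t; -t, 2]) ψ * source (0 : Fin 2 → ℝ) ψ) := by
    intro G
    rw [integral_transport e]
    refine integral_congr_ae (Filter.Eventually.of_forall fun ψ => ?_)
    simp only [src_zero, source_zero_apply, mul_one, B2Eq228Conditioning.weight, quadForm_transport, hmat]
  have hnum : ∀ ψ : Fin 2 → ℝ, obs cube4 obs4 X (fun y => ψ (e.symm y)) = (ψ ⬝ᵥ Pi.single k 1) * (ψ ⬝ᵥ Pi.single k 1) := by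
    intro ψ
    rw [hobs, dotProduct_single_one, Equiv.symm_apply_apply, sq]
  rw [zW, zG, BIJ88PolymerRep5134Gauss.expect, htr]
  have h1 := htr (fun _ => 1)
  simp only [one_mul] at h1
  rw [h1]
  simp_rw [hnum]
  rw [pair_vacuum _ hA' 0 (Pi.single k 1) (Pi.single k 1)]
  have hZ := integral_weight_mul_source_pos hA' (0 : Fin 2 → ℝ)
  simp only [dotProduct_zero, mul_zero, add_zero]
  rw [mul_div_cancel_right₀ _ hZ.ne', dotProduct_single_one, mulVec_single_one]
  -- the inverse of `[[2,−t],[−t,2]]`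
  have hdet : (4 : ℝ) - t ^ 2 ≠ 0 := by
    intro h
    linarith
  have h00 : 2 / (4 - t ^ 2) * 2 + t / (4 - t ^ 2) * -t = 1 := by
    field_simp
    ring
  have h01 : 2 / (4 - t ^ 2) * -t + t / (4 - t ^ 2) * 2 = 0 := by ring
  have h10 : t / (4 - t ^ 2) * 2 + 2 / (4 - t ^ 2) * -t = 0 := by ring
  have h11 : t / (4 - t ^ 2) * -t + 2 / (4 - t ^ 2) * 2 = 1 := by
    field_simp
    ring
  have hinv : (!![2, -t; -t, 2] : Matrix (Fin 2) (Fin 2) ℝ)⁻¹ = !![2 / (4 - t ^ 2), t / (4 - t ^ 2); t / (4 - t ^ 2), 2 / (4 - t ^ 2)] := by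
    refine Matrix.inv_eq_left_inv ?_
    rw [Matrix.mul_fin_two, h00, h01, h10, h11, Matrix.one_fin_two]
  rw [hinv]
  fin_cases k
  · rfl
  · rfl

/-- the two sites of the pair `{0,1}`. [cite: BalabanImbrieJaffe1988, (5.13.4) p.306] -/
def e01 : Fin 2 ≃ BIJ88PolymerRep5134Gauss.Site cube4 ({0, 1} : Finset (Fin 4)) where
  toFun k := if k = 0 then ⟨0, by decide⟩ else ⟨1, by decide⟩
  invFun y := if y.1 = 0 then 0 else 1
  left_inv k := by
    fin_cases k <;> simp
  right_inv y := by
    obtain ⟨y, hy⟩ := y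
    have hy' : y = 0 ∨ y = 1 := by simpa using hy
    rcases hy' with rfl | rfl <;> simp

/-- the two sites of the pair `{2,3}`. [cite: BalabanImbrieJaffe1988, (5.13.4) p.306] -/
def e23 : Fin 2 ≃ BIJ88PolymerRep5134Gauss.Site cube4 ({2, 3} : Finset (Fin 4)) where
  toFun k := if k = 0 then ⟨2, by decide⟩ else ⟨3, by decide⟩
  invFun y := if y.1 = 2 then 0 else 1
  left_inv k := by
    fin_cases k <;> simp
  right_inv y := by
    obtain ⟨y, hy⟩ := y
    have hy' : y = 2 ∨ y = 3 := by simpa using hy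
    rcases hy' with rfl | rfl <;> simp (config := { decide := true })

/-- the corner values of a 0/1 parameter. [cite: BalabanImbrieJaffe1988, p.305 (Sect. 5.13)] -/
theorem corner_sq_lt (Λ : Finset (Fin 4)) (i j : Fin 4) : (corner ℝ Λ i * corner ℝ Λ j) ^ 2 < 4 := by
  simp only [corner]
  split_ifs <;> norm_num

/-- **`⟨Φ₀²⟩_{1_Λ,{0,1}} = 2/(4 − (s₀s₁)²)`**: `2/3` when both cubes are active (coupled), `1/2` otherwise (decoupled).
[cite: BalabanImbrieJaffe1988, (5.13.4) p.306] -/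
theorem zW_pair01 (Λ : Finset (Fin 4)) : zW {0, 1} Λ = 2 / (4 - (corner ℝ Λ 0 * corner ℝ Λ 1) ^ 2) := by
  refine zW_two_site {0, 1} Λ e01 0 (fun φ => ?_) _ ?_ (corner_sq_lt Λ 0 1)
  · have h0 : cube4 0 ∈ ({0, 1} : Finset (Fin 4)) := by decide
    have hA : obs4 0 (BIJ88PolymerRep5134Gauss.ext cube4 {0, 1} φ) = φ (e01 0) ^ 2 := by
      rw [obs4, if_pos (Or.inl rfl)]
      show (if h : cube4 0 ∈ ({0, 1} : Finset (Fin 4)) then φ ⟨0, h⟩ else 0) ^ 2 = _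
      rw [dif_pos h0]
      rfl
    have hB : obs4 1 (BIJ88PolymerRep5134Gauss.ext cube4 {0, 1} φ) = 1 := by
      rw [obs4, if_neg (show ¬ ((1 : Fin 4) = 0 ∨ (1 : Fin 4) = 3) by decide)]
    rw [obs, prod_pair (show (0 : Fin 4) ≠ 1 by decide), hA, hB, mul_one]
  · ext i j
    fin_cases i <;> fin_cases j <;>
      simp (config := { decide := true }) [prec, interpForm_apply, pathΔ, nn4, e01, Matrix.submatrix_apply]
    ring

/-- **`⟨Φ₃²⟩_{1_Λ,{2,3}} = 2/(4 − (s₂s₃)²)`**. [cite: BalabanImbrieJaffe1988, (5.13.4) p.306] -/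
theorem zW_pair23 (Λ : Finset (Fin 4)) : zW {2, 3} Λ = 2 / (4 - (corner ℝ Λ 2 * corner ℝ Λ 3) ^ 2) := by
  refine zW_two_site {2, 3} Λ e23 1 (fun φ => ?_) _ ?_ (corner_sq_lt Λ 2 3)
  · have h3 : cube4 3 ∈ ({2, 3} : Finset (Fin 4)) := by decide
    have hA : obs4 3 (BIJ88PolymerRep5134Gauss.ext cube4 {2, 3} φ) = φ (e23 1) ^ 2 := by
      rw [obs4, if_pos (Or.inr rfl)]
      show (if h : cube4 3 ∈ ({2, 3} : Finset (Fin 4)) then φ ⟨3, h⟩ else 0) ^ 2 = _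
      rw [dif_pos h3]
      rfl
    have hB : obs4 2 (BIJ88PolymerRep5134Gauss.ext cube4 {2, 3} φ) = 1 := by
      rw [obs4, if_neg (show ¬ ((2 : Fin 4) = 0 ∨ (2 : Fin 4) = 3) by decide)]
    rw [obs, prod_pair (show (2 : Fin 4) ≠ 3 by decide), hA, hB, one_mul]
  · ext i j
    fin_cases i <;> fin_cases j <;>
      simp (config := { decide := true }) [prec, interpForm_apply, pathΔ, nn4, e23, Matrix.submatrix_apply]
    ring

/-! ## §4 The activities of the two abutting pairs: `g₁({0,1}) = g₁({2,3}) = 1/6` -/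

/-- the subsets of a pair. [cite: BalabanImbrieJaffe1988, (5.13.4) p.306] -/
theorem powerset_pair01 : ({0, 1} : Finset (Fin 4)).powerset = {∅, {0}, {1}, {0, 1}} := by decide

/-- the subsets of a pair. [cite: BalabanImbrieJaffe1988, (5.13.4) p.306] -/
theorem powerset_pair23 : ({2, 3} : Finset (Fin 4)).powerset = {∅, {2}, {3}, {2, 3}} := by decide

/-- **`g₁({0,1}) = ⟨Φ₀²⟩_{coupled} − ⟨Φ₀²⟩_{decoupled} = 2/3 − 1/2 = 1/6`** (the connected part of the abutting pair does NOT vanish).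
[cite: BalabanImbrieJaffe1988, (5.13.4) p.306] -/
theorem g1_pair01 : g1 nn4 zW {0, 1} = 1 / 6 := by
  rw [g1_of_two_le nn4 zW (by decide : 2 ≤ ({0, 1} : Finset (Fin 4)).card), if_pos (by decide : IsConn nn4 ({0, 1} : Finset (Fin 4))),
    act, cornerSum, powerset_pair01]
  rw [sum_insert (by decide), sum_insert (by decide), sum_insert (by decide), sum_singleton]
  simp only [zW_pair01, corner]
  simp (config := { decide := true })
  norm_num

/-- **`g₁({2,3}) = 1/6`**. [cite: BalabanImbrieJaffe1988, (5.13.4) p.306] -/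
theorem g1_pair23 : g1 nn4 zW {2, 3} = 1 / 6 := by
  rw [g1_of_two_le nn4 zW (by decide : 2 ≤ ({2, 3} : Finset (Fin 4)).card), if_pos (by decide : IsConn nn4 ({2, 3} : Finset (Fin 4))),
    act, cornerSum, powerset_pair23]
  rw [sum_insert (by decide), sum_insert (by decide), sum_insert (by decide), sum_singleton]
  simp only [zW_pair23, corner]
  simp (config := { decide := true })
  norm_num

/-! ## §5 The over-count: summed over ALL set partitions of the four cubes, `Σ Π g₁ = ⟨Φ₀²Φ₃²⟩_1 + 1/36 ≠ ⟨Φ₀²Φ₃²⟩_1` -/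

/-- the only pair of DISJOINT CONNECTED two-cube regions among four cubes in a row is `{0,1}`, `{2,3}`. [cite: BalabanImbrieJaffe1988, (5.13.4) p.306] -/
theorem pair_eq_of_isConn : ∀ X ∈ (univ : Finset (Fin 4)).powerset, ∀ X' ∈ (univ : Finset (Fin 4)).powerset, X.card = 2 → X'.card = 2 →
    Disjoint X X' → IsConn nn4 X → IsConn nn4 X' → ({X, X'} : Finset (Finset (Fin 4))) = {{0, 1}, {2, 3}} := by
  decide

/-- the two abutting pairs are connected regions. [cite: BalabanImbrieJaffe1988, (5.13.4) p.306] -/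
theorem isConn_of_mem_P0 {X : Finset (Fin 4)} (hX : X ∈ ({{0, 1}, {2, 3}} : Finset (Finset (Fin 4)))) : IsConn nn4 X := by
  simp only [mem_insert, mem_singleton] at hX
  rcases hX with rfl | rfl <;> decide

/-- **the contribution of a NON-admissible set partition of the four cubes**: a partition of a `4`-set with two distinct blocks of `≥ 2` cubes is a
pair of complementary `2`-sets `{X, X'}`; its term `g₁(X)g₁(X')` is `1/36` for `{{0,1},{2,3}}` (both blocks connected, `g1_pair01/23`) and `0`
otherwise (a disconnected block has `g₁ = 0`, `g1_of_two_le`). [cite: BalabanImbrieJaffe1988, (5.13.4) p.306] -/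
theorem prod_g1_of_not_isAdmissible {P : Finset (Finset (Fin 4))} (hP : P ∈ setPartitions (univ : Finset (Fin 4)))
    (hna : ¬ IsAdmissible nn4 P) :
    ∏ X ∈ P, g1 nn4 zW X = if P = {{0, 1}, {2, 3}} then 1 / 36 else 0 := by
  have hSP := mem_setPartitions.1 hP
  simp only [IsAdmissible, not_forall, exists_prop] at hna
  obtain ⟨X, hX, X', hX', hne, h2, h2', -⟩ := hna
  have hd : Disjoint X X' := hSP.disjoint hX hX' hne
  have hu : (X ∪ X').card = X.card + X'.card := card_union_of_disjoint hd
  have hle : (X ∪ X').card ≤ 4 := (card_le_univ (X ∪ X')).trans_eq (by simp)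
  have hX2 : X.card = 2 := by omega
  have hX'2 : X'.card = 2 := by omega
  have hXX' : X ∪ X' = univ := eq_univ_of_card _ (by simp; omega)
  have hPeq : P = {X, X'} := by
    ext Q
    simp only [mem_insert, mem_singleton]
    refine ⟨fun hQ => ?_, ?_⟩
    · obtain ⟨v, hv⟩ := hSP.nonempty_of_mem hQ
      have hv' : v ∈ X ∪ X' := hXX' ▸ mem_univ v
      rcases mem_union.1 hv' with hvX | hvX'
      · exact Or.inl (hSP.eq_of_mem hQ hX hv hvX)
      · exact Or.inr (hSP.eq_of_mem hQ hX' hv hvX')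
    · rintro (rfl | rfl)
      · exact hX
      · exact hX'
  by_cases hc : IsConn nn4 X ∧ IsConn nn4 X'
  · have hP0 : P = {{0, 1}, {2, 3}} := hPeq.trans
      (pair_eq_of_isConn X (mem_powerset.2 (subset_univ X)) X' (mem_powerset.2 (subset_univ X')) hX2 hX'2 hd hc.1 hc.2)
    rw [if_pos hP0, hP0, prod_pair (by decide), g1_pair01, g1_pair23]
    norm_num
  · have h0 : g1 nn4 zW X * g1 nn4 zW X' = 0 := by
      rw [g1_of_two_le nn4 zW h2, g1_of_two_le nn4 zW h2']
      rcases not_and_or.1 hc with h | h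
      · rw [if_neg h, zero_mul]
      · rw [if_neg h, mul_zero]
    have hPne : P ≠ {{0, 1}, {2, 3}} := by
      rintro rfl
      exact hc ⟨isConn_of_mem_P0 hX, isConn_of_mem_P0 hX'⟩
    rw [if_neg hPne, hPeq, prod_pair hne, h0]

/-- `{{0,1},{2,3}}` is a set partition of the four cubes (a filling of `Λ₁₀` by two abutting two-cube polymers) and is NOT admissible.
[cite: BalabanImbrieJaffe1988, (5.13.4) p.306] -/
theorem P0_mem_filter : ({{0, 1}, {2, 3}} : Finset (Finset (Fin 4)))
    ∈ (setPartitions (univ : Finset (Fin 4))).filter (fun P => ¬ IsAdmissible nn4 P) :=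
  mem_filter.2 ⟨mem_setPartitions.2 (by decide), by decide⟩

/-- **the all-set-partitions sum over-counts by exactly `g₁({0,1})·g₁({2,3}) = 1/36`**:
`Σ_{P ∈ setPartitions} Π_{X∈P} g₁(X) = ⟨Φ₀²Φ₃²⟩_{1} + 1/36` for the four-cube Gaussian witness. [cite: BalabanImbrieJaffe1988, (5.13.4) p.306] -/
theorem sum_setPartitions_univ :
    ∑ P ∈ setPartitions (univ : Finset (Fin 4)), ∏ X ∈ P, g1 nn4 zW X = zW univ univ + 1 / 36 := by
  rw [sum_setPartitions_eq isClusterFactorizing_zW univ,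
    sum_congr rfl fun P hP => prod_g1_of_not_isAdmissible (mem_filter.1 hP).1 (mem_filter.1 hP).2]
  simp only [sum_ite_eq', if_pos P0_mem_filter]

/-- **THE WITNESS.** For the ACTUAL Gaussian expectations of Sect. 5.13 (here: four cubes in a row, one real field component per cube,
nearest-neighbour precision `pathΔ ≻ 0`, no linear term, `f(□₀) = Φ₀²`, `f(□₃) = Φ₃²`, `f(□₁) = f(□₂) = 1`), display (5.13.4) read with
`{X_α}` ranging over ALL set partitions of `Λ₁₀` into unions of cubes is FALSE (`Σ_{all P} Π g₁ ≠ ⟨Π f(□_i)⟩_1`), while the printed identity holds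
with the fillings the cube-wise interpolation `□_iΔ_s□_j = s_is_j□_iΔ□_j` actually produces — the ADMISSIBLE ones (no two abutting polymers of `≥ 2`
cubes; `polymerRep` / `polymerRep_gauss`). [cite: BalabanImbrieJaffe1988, (5.13.4) p.306] -/
theorem sum_setPartitions_ne_univ :
    (∑ P ∈ setPartitions (univ : Finset (Fin 4)), ∏ X ∈ P, g1 nn4 zW X) ≠ zW univ univ
      ∧ zW univ univ = ∑ P ∈ (setPartitions (univ : Finset (Fin 4))).filter (IsAdmissible nn4), ∏ X ∈ P, g1 nn4 zW X := by
  refine ⟨?_, polymerRep isClusterFactorizing_zW univ⟩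
  rw [sum_setPartitions_univ]
  intro h
  linarith

end Literature.MathematicalPhysics.QuantumFieldTheory.BalabanImbrieJaffe1984to88.BIJ88PolymerRep5134GaussWitness

end
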